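import Summits.QuantumFields.YangMills.Theorems.UnitScaleTiltProp7OneFormGreenBlockColumn
import Summits.QuantumFields.YangMills.Theorems.UnitScaleTiltProp7OneFormGreenKernelRowOfLiftAbs
import HarnessLib

/-!
# Route `UnitScaleTilt`, crux K1 «MinimiserStabilityRegPr» (stmt-QuantumFields-19200), EX row `norm_G` ∕ (K2)-storey — pens N4 + (K2-L1) UNDER `Lift`:
# **THE SUP BOUND AND THE BLOCK-`L¹` COLUMN OF `G₀ = Δ_a(U₀)⁻¹` AT `RegPr` UNDER `Lift`, COUPLING-FREE (C_V)** — the A2i knit (px21 g14 ✓`kernelRow_GT_DeltaEtaSlot_of_lift_abs`) for N4 §2 and (K2-L1) §3b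

Cell `ym3-torus` (HUMAN RULING D-0037; rung R3 = SU(2) YM₃ on T³ — NOT d = 4, NOT infinite volume, NOT a mass gap, NOT Clay).  Width seat `ym3-torus-px16` g13
(`--supports stmt-QuantumFields-19200 --as helper`).  THEOREMS ONLY (0 `def`, 0 `sorry`, default heartbeats); count-neutral.

WHAT.  N4 ✓`norm_symm_GT_apply_le_of_letters` ((V) for `G₀`: `‖toL2⁻¹(G₀ toL2 X)‖_∞ ≤ A₂(2(1+2∕min r ¼))³·s`) and (K2-L1) ✓`blockColumn_GT_DeltaEtaSlot_of_letters` (block-`L¹` column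
`≤ 2A₂·e^{−(min r ¼∕2)·tdist}·‖Z‖`) display the letters (γ) `hco`, (C_V) `hVlow`, (θ_V-class) `hVconj`, `PosOnto`, `hkQ`; this file FEEDS all but (γ) and `hk_D` BY NAME exactly as A2i does:
`PosOnto` ⟸ (γ) + ✓`surjective_Qk_of_regPr`; `hQ` ⟸ ✓`norm_Qk_le_of_regPr`; `hVconj` ⟸ ✓`hVconj_phaseClass_of_letters`; `hVlow` ⟸ ✓`hVlow_abs_of_lift` (ABSOLUTE `C_V`); `hkQ` ⟸ ✓`hkQ_of_regPr`.
Displayed (VERBATIM A2i's): `n < K`; `RegPr F n K ε₀ U₀`, `0 < ε₀`, `10¹²L³ε₀ ≤ 1`, `10¹⁰L⁶ε₀ ≤ 1`, `13·10¹⁴L³ε₀ ≤ 1`; `Lift`; `0 ≤ a`; (γ) `hco` with `0 < γ`; `hk_D` at `μ′ > r > 0`;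
`0 < ε ≤ 1`; `0 < Θ_r` (absolute `C_V`, A2g's `θ_V` at `Ck := CkD`, `C_Q := 6√(cB∕c₀)√ℓ⁻³`); `(32√2ε₀e^{5r})(8e^{3r})·14 < 1`.
* ★★★ `norm_symm_GT_apply_le_of_lift_abs` — THEN `∀ X s, (∀ b, ‖X b‖ ≤ s) → ∀ bd, ‖toL2⁻¹(G₀(toL2 X)) bd‖ ≤ A₂·(2(1+1∕(min r ¼∕2)))³·s` (N4 §2's constant with the fed letters).
* ★★★ `blockColumn_GT_DeltaEtaSlot_of_lift_abs` — THEN `∀ b Z y, Σ_{bd : B bd₋ = y} ‖toL2⁻¹(G₀(toL2 δ_bZ)) bd‖ ≤ (2A₂)·e^{−(min r ¼∕2)·tdist(y, B b₋)}·‖Z‖` ((K3)∕(K4) door's `hGcol`).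
HONEST SCOPE.  A re-knit of landed theorems; CONDITIONAL on (γ) `hco`, `hk_D`, `Lift` and the displayed numeric conditions; K-freeness of the VALUES is the Idx package's business
(`a` at the floor `a₀(c₀∕cB)ℓ³`, `CkD ∝ ℓ⁻³`); nothing of `norm_G`, `hCk`, the EX rows, EX or the crux is proved; no summit is proved by a helper.  Credit: knit pattern = px21 g14's A2i.

References: T. Bałaban, CMP **99** (1985) 389–434 [Balaban1985BackgroundPropagators] (Thm 3.3 (3.46)–(3.49) pp.398–399, Thm 3.1 (3.42) p.397, (3.21)–(3.27) pp.394–395,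
Thm 3.11 p.416, Thm 3.12 p.422).
-/

set_option autoImplicit false

noncomputable section

open scoped Matrix.Norms.L2Operator BigOperators InnerProductSpace ComplexConjugate

namespace Summit.QuantumFields.YangMills.Theorems.Prop7OneFormGreenBlockColumnOfLiftAbs

open Literature.MathematicalPhysics.QuantumFieldTheory.Balaban1983to89
open Literature.MathematicalPhysics.QuantumFieldTheory.Balaban1983to89.T3ContinuumYM3Torus
open Literature.MathematicalPhysics.QuantumFieldTheory.Balaban1983to89.T3PrintedRegularMinimiser (RegPr)
open B15DeterminingSets (embIter)
open T3SectALandauChart (formComp bgUnits eta eta_pos)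
open B9SectCLatticeCarrier (Bond)
open B9Eq311L2Pairing (WL2)
open B11Eq103H1Complex (BondL2K)
open B5Eq118OneStroke (iterBlockOf)
open Summit.QuantumFields.YangMills.Theorems.Prop8Chart (emlIterU)
open Summit.QuantumFields.YangMills.Theorems.Prop7SectET3Transport (periodsT3 bondEquiv)
open Summit.QuantumFields.YangMills.Theorems.Prop7SectET3HilbertLetters (W₂ frobEquiv toL2 toL2S DL2 DstarL2)
open Summit.QuantumFields.YangMills.Theorems.Prop7SectET3WilsonHessian (DeltaEtaSlot)
open Summit.QuantumFields.YangMills.Theorems.Prop7SectET3GaugeProjector (RS)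
open Summit.QuantumFields.YangMills.Theorems.Prop7SectET3CurvedPropagators (laplaceA Qk GT PosOnto)
open Summit.QuantumFields.YangMills.Theorems.Prop7OneFormAgmonPhaseClass (hVconj_phaseClass_of_letters)
open Summit.QuantumFields.YangMills.Theorems.Prop7QkPenaltyKernelRowOfRegPr (hkQ_of_regPr)
open Summit.QuantumFields.YangMills.Theorems.Prop7QkAdjointSupRowOfRegPr (norm_Qk_le_of_regPr)
open Summit.QuantumFields.YangMills.Theorems.Prop7QkOntoOfRegPr (surjective_Qk_of_regPr)
open Summit.QuantumFields.YangMills.Theorems.Prop7OneFormRemainderFloorOfLift (hVlow_abs_of_lift)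
open Summit.QuantumFields.YangMills.Theorems.Prop7OneFormGreenSupBound (norm_symm_GT_apply_le_of_letters)
open Summit.QuantumFields.YangMills.Theorems.Prop7OneFormGreenBlockColumn (blockColumn_GT_DeltaEtaSlot_of_letters)

variable (F : T3Family) {n K : ℕ} (h : n ≤ K) (c₀ cB : ℝ) [Fact (0 < c₀)] [Fact (0 < cB)]

/-- ★★★ **(V) FOR `G₀` UNDER `Lift` AT `RegPr`, COUPLING-FREE (C_V)**: N4 ✓`norm_symm_GT_apply_le_of_letters` with `PosOnto`, `hQ`, `hVconj`, `hVlow` (absolute `C_V`), `hkQ` fed by name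
(A2i's knit); displayed: `RegPr` + windows, `Lift`, `0 ≤ a`, (γ) `hco`, `hk_D`, the numeric `(r, ε)` conditions.  THEN `‖toL2⁻¹(G₀(toL2 X)) bd‖ ≤ A₂·(2(1+1∕(min r ¼∕2)))³·s` whenever
`‖X b‖ ≤ s`.  CONDITIONAL on the displayed letters. [cite: Balaban1985BackgroundPropagators, Thm 3.3 (3.47) p.398, Thm 3.1 (3.42) p.397, (3.46) p.398, Thm 3.12 p.422] -/
theorem norm_symm_GT_apply_le_of_lift_abs (hnK : n < K) {ε₀ : ℝ} (hε₀ : 0 < ε₀) (hWε : 10 ^ 12 * (F.L : ℝ) ^ 3 * ε₀ ≤ 1)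
    (hε10 : 10 ^ 10 * (F.L : ℝ) ^ 6 * ε₀ ≤ 1) (hwin : 13 * 10 ^ 14 * (F.L : ℝ) ^ 3 * ε₀ ≤ 1)
    (U₀ : GaugeField (F.P K) 0 (Matrix.specialUnitaryGroup (Fin 2) ℂ)) (hreg : RegPr F n K ε₀ U₀)
    (hlift : ∀ cf : Site (F.P K) (K - n) → Matrix (Fin 2) (Fin 2) ℂ,
        (∀ e : PBond (F.P K) (K - n), cf e.src = ((emlIterU (K - n) (bgUnits F K U₀) e : (Matrix (Fin 2) (Fin 2) ℂ)ˣ) : Matrix (Fin 2) (Fin 2) ℂ) * cf e.tgt *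
          (((emlIterU (K - n) (bgUnits F K U₀) e)⁻¹ : (Matrix (Fin 2) (Fin 2) ℂ)ˣ) : Matrix (Fin 2) (Fin 2) ℂ)) →
        ∃ l₀ : Site (F.P K) 0 → Matrix (Fin 2) (Fin 2) ℂ,
          (∀ b : PBond (F.P K) 0, l₀ b.src = ((bgUnits F K U₀ b : (Matrix (Fin 2) (Fin 2) ℂ)ˣ) : Matrix (Fin 2) (Fin 2) ℂ) * l₀ b.tgt * (((bgUnits F K U₀ b)⁻¹ : (Matrix (Fin 2) (Fin 2) ℂ)ˣ) : Matrix (Fin 2) (Fin 2) ℂ)) ∧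
          ∀ y : Site (F.P K) (K - n), l₀ (embIter (K - n) y) = cf y)
    {a : ℝ} (ha : 0 ≤ a)
    {γ : ℝ} (hγ : 0 < γ) (hco : ∀ v : BondL2K ℂ 3 (periodsT3 F K) c₀ W₂, γ * ‖v‖ ^ 2 ≤ RCLike.re ⟪v, laplaceA F n K h c₀ cB a (DeltaEtaSlot F n K c₀) U₀ v⟫_ℂ)
    {r μ' CkD : ℝ} (hr : 0 < r) (hrμ : r < μ') (hCkD : 0 ≤ CkD)
    (hkD : ∀ (b : PBond (F.P K) 0) (Z : Matrix (Fin 2) (Fin 2) ℂ) (bd : PBond (F.P K) 0),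
      ‖(toL2 F K c₀).symm (DL2 F n K c₀ U₀ (DstarL2 F n K c₀ U₀ (toL2 F K c₀ (Pi.single b Z))
          - RS F n K h c₀ cB U₀ (DstarL2 F n K c₀ U₀ (toL2 F K c₀ (Pi.single b Z))))) bd‖
        ≤ CkD * Real.exp (-(μ' * (Site.tdist (P := F.P K) (iterBlockOf (K - n) b.src) (iterBlockOf (K - n) bd.src) : ℝ))) * ‖Z‖)
    {ε : ℝ} (hε : 0 < ε) (hε1 : ε ≤ 1)
    (hΘ : 0 < ((1 - ε) * γ - ε * ((32 * Real.sqrt 2 * ε₀ * (((F.P K).d : ℝ) * (2 * 3) ^ (F.P K).d)) + (33 / 8 : ℝ) ^ 2 * (600 * (27 / 4 : ℝ) ^ 6)) - 3 * (r ^ 2 * Real.exp (2 * r)) * (1 + 1 / ε)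
            - (a * (2 * Real.sqrt (216 * (Real.exp (r * (((F.P K).d : ℝ) + 1)) - 1) ^ 2 * (cB / (c₀ * ((F.L : ℝ) ^ (K - n)) ^ 3))) * (6 * Real.sqrt (cB / c₀) * Real.sqrt (((F.L : ℝ) ^ (K - n))⁻¹ ^ 3))
                  + 216 * (Real.exp (r * (((F.P K).d : ℝ) + 1)) - 1) ^ 2 * (cB / (c₀ * ((F.L : ℝ) ^ (K - n)) ^ 3)))
              + Real.sqrt 2 * CkD * (r * (F.P K).d * Real.exp (r * (F.P K).d) / min 1 ((μ' - r) / 2))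
                  * (((F.P K).d : ℝ) * ((((F.P K).L : ℝ) ^ (F.P K).d) ^ (K - n)) * (2 * (1 + 1 / (μ' - (r + min 1 ((μ' - r) / 2))))) ^ 3)
              + 32 * Real.sqrt 2 * ε₀ * (((F.P K).d : ℝ) * (2 * 3) ^ (F.P K).d) * (1 + Real.exp (2 * r)))))
    (hsmall : (32 * Real.sqrt 2 * ε₀ * Real.exp (5 * r)) * (8 * Real.exp (3 * r)) * 14 < 1)
    (X : PBond (F.P K) 0 → Matrix (Fin 2) (Fin 2) ℂ) {s : ℝ} (hs : 0 ≤ s) (hX : ∀ b, ‖X b‖ ≤ s) (bd : PBond (F.P K) 0) :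
    ‖(toL2 F K c₀).symm (GT F n K h c₀ cB a (DeltaEtaSlot F n K c₀) U₀ (toL2 F K c₀ X)) bd‖
      ≤ (((Real.sqrt 2 + Real.sqrt 2 * (((2 * a * 5 ^ 2 * (cB / c₀) * ((F.L : ℝ) ^ (K - n))⁻¹ ^ 6 * Real.exp μ') + CkD) * Real.sqrt (((F.P K).d : ℝ) * ((((F.P K).L : ℝ) ^ (F.P K).d) ^ (K - n)) / c₀) * (Real.exp (6 * r) * Real.sqrt (2 * c₀ * (((F.P K).d : ℝ) * ((((F.P K).L : ℝ) ^ (F.P K).d) ^ (K - n)))) / ((1 - ε) * γ - ε * ((32 * Real.sqrt 2 * ε₀ * (((F.P K).d : ℝ) * (2 * 3) ^ (F.P K).d)) + (33 / 8 : ℝ) ^ 2 * (600 * (27 / 4 : ℝ) ^ 6)) - 3 * (r ^ 2 * Real.exp (2 * r)) * (1 + 1 / ε) - ((a * (2 * Real.sqrt (216 * (Real.exp (r * (((F.P K).d : ℝ) + 1)) - 1) ^ 2 * (cB / (c₀ * ((F.L : ℝ) ^ (K - n)) ^ 3))) * (6 * Real.sqrt (cB / c₀) * Real.sqrt (((F.L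 : ℝ) ^ (K - n))⁻¹ ^ 3))
                  + 216 * (Real.exp (r * (((F.P K).d : ℝ) + 1)) - 1) ^ 2 * (cB / (c₀ * ((F.L : ℝ) ^ (K - n)) ^ 3)))
              + Real.sqrt 2 * CkD * (r * (F.P K).d * Real.exp (r * (F.P K).d) / min 1 ((μ' - r) / 2))
                  * (((F.P K).d : ℝ) * ((((F.P K).L : ℝ) ^ (F.P K).d) ^ (K - n)) * (2 * (1 + 1 / (μ' - (r + min 1 ((μ' - r) / 2))))) ^ 3)
              + 32 * Real.sqrt 2 * ε₀ * (((F.P K).d : ℝ) * (2 * 3) ^ (F.P K).d) * (1 + Real.exp (2 * r)))))) * (2 * (1 + 1 / (μ' - r))) ^ 3)) * (8 * Real.exp (3 * r)) * 14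
              + Real.sqrt (3 ^ 3 * 8 / (c₀ * ((F.L : ℝ) ^ (K - n)) ^ 3)) * (Real.sqrt (8 * Real.exp (3 * r) * (2 * (1 + 1 / r)) ^ 3) * (Real.exp (6 * r) * Real.sqrt (2 * c₀ * (((F.P K).d : ℝ) * ((((F.P K).L : ℝ) ^ (F.P K).d) ^ (K - n)))) / ((1 - ε) * γ - ε * ((32 * Real.sqrt 2 * ε₀ * (((F.P K).d : ℝ) * (2 * 3) ^ (F.P K).d)) + (33 / 8 : ℝ) ^ 2 * (600 * (27 / 4 : ℝ) ^ 6)) - 3 * (r ^ 2 * Real.exp (2 * r)) * (1 + 1 / ε) - ((a * (2 * Real.sqrt (216 * (Real.exp (r * (((F.P K).d : ℝ) + 1)) - 1) ^ 2 * (cB / (c₀ * ((F.L : ℝ) ^ (K - n)) ^ 3))) * (6 * Real.sqrt (cB / c₀) * Real.sqrt (((F.L : ℝ) ^ (K - n))⁻¹ ^ 3))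
                  + 216 * (Real.exp (r * (((F.P K).d : ℝ) + 1)) - 1) ^ 2 * (cB / (c₀ * ((F.L : ℝ) ^ (K - n)) ^ 3)))
              + Real.sqrt 2 * CkD * (r * (F.P K).d * Real.exp (r * (F.P K).d) / min 1 ((μ' - r) / 2))
                  * (((F.P K).d : ℝ) * ((((F.P K).L : ℝ) ^ (F.P K).d) ^ (K - n)) * (2 * (1 + 1 / (μ' - (r + min 1 ((μ' - r) / 2))))) ^ 3)
              + 32 * Real.sqrt 2 * ε₀ * (((F.P K).d : ℝ) * (2 * 3) ^ (F.P K).d) * (1 + Real.exp (2 * r))))))))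
            / (1 - (32 * Real.sqrt 2 * ε₀ * Real.exp (5 * r)) * (8 * Real.exp (3 * r)) * 14))
        * (2 * (1 + 1 / (min r (1 / 4) / 2))) ^ 3 * s := by
  have hc₀ : 0 < c₀ := Fact.out
  have hcB : 0 < cB := Fact.out
  have hp : PosOnto F n K h c₀ cB a (DeltaEtaSlot F n K c₀) U₀ :=
    ⟨fun x hx => lt_of_lt_of_le (mul_pos hγ (pow_pos (norm_pos_iff.mpr hx) 2)) (hco x), surjective_Qk_of_regPr F h hnK c₀ cB hreg hwin⟩
  have hQ : ∀ v : BondL2K ℂ 3 (periodsT3 F K) c₀ W₂, ‖Qk F n K h c₀ cB U₀ v‖ ≤ (6 * Real.sqrt (cB / c₀) * Real.sqrt (((F.L : ℝ) ^ (K - n))⁻¹ ^ 3)) * ‖v‖ :=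
    fun v => norm_Qk_le_of_regPr F h c₀ cB hε₀ hε10 hWε U₀ hreg v
  have hVconj := hVconj_phaseClass_of_letters F h c₀ cB (a := a) hε₀ hε10 hWε U₀ hreg ha hr.le hrμ hCkD hkD hQ
  have hVlow := hVlow_abs_of_lift F h c₀ cB (a := a) hnK hε₀ hWε U₀ hreg ha hlift
  have hkQ := hkQ_of_regPr F h c₀ cB hε₀ hε10 hWε U₀ hreg ha (le_of_lt (hr.trans hrμ))
  exact norm_symm_GT_apply_le_of_letters (h := h) (cB := cB) (a := a) hnK.le hε₀.le U₀ hreg hp hr hε hε1 hco hVlow hVconj hΘ hCkD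
    (by positivity) hrμ hkD hkQ hsmall X hs hX bd

/-- ★★★ **THE BLOCK-`L¹` COLUMN OF `G₀` UNDER `Lift` AT `RegPr`, COUPLING-FREE (C_V)** — (K2-L1) ✓`blockColumn_GT_DeltaEtaSlot_of_letters` with the same letters fed by name;
displayed: `RegPr` + windows, `Lift`, `0 ≤ a`, (γ) `hco`, `hk_D`, the numeric `(r, ε)` conditions.  THEN the (K3)∕(K4) door's `hGcol` text at `Δx := DeltaEtaSlot`:
`∀ b Z y, Σ_{bd : B bd₋ = y} ‖toL2⁻¹(G₀(toL2 δ_bZ)) bd‖ ≤ (2A₂)·e^{−(min r ¼∕2)·tdist(y, B b₋)}·‖Z‖`.  CONDITIONAL on the displayed letters.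
[cite: Balaban1985BackgroundPropagators, Thm 3.3 (3.46)–(3.49) pp.398–399, Thm 3.1 (3.42) p.397, Thm 3.12 p.422] -/
theorem blockColumn_GT_DeltaEtaSlot_of_lift_abs (hnK : n < K) {ε₀ : ℝ} (hε₀ : 0 < ε₀) (hWε : 10 ^ 12 * (F.L : ℝ) ^ 3 * ε₀ ≤ 1)
    (hε10 : 10 ^ 10 * (F.L : ℝ) ^ 6 * ε₀ ≤ 1) (hwin : 13 * 10 ^ 14 * (F.L : ℝ) ^ 3 * ε₀ ≤ 1)
    (U₀ : GaugeField (F.P K) 0 (Matrix.specialUnitaryGroup (Fin 2) ℂ)) (hreg : RegPr F n K ε₀ U₀)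
    (hlift : ∀ cf : Site (F.P K) (K - n) → Matrix (Fin 2) (Fin 2) ℂ,
        (∀ e : PBond (F.P K) (K - n), cf e.src = ((emlIterU (K - n) (bgUnits F K U₀) e : (Matrix (Fin 2) (Fin 2) ℂ)ˣ) : Matrix (Fin 2) (Fin 2) ℂ) * cf e.tgt *
          (((emlIterU (K - n) (bgUnits F K U₀) e)⁻¹ : (Matrix (Fin 2) (Fin 2) ℂ)ˣ) : Matrix (Fin 2) (Fin 2) ℂ)) →
        ∃ l₀ : Site (F.P K) 0 → Matrix (Fin 2) (Fin 2) ℂ,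
          (∀ b : PBond (F.P K) 0, l₀ b.src = ((bgUnits F K U₀ b : (Matrix (Fin 2) (Fin 2) ℂ)ˣ) : Matrix (Fin 2) (Fin 2) ℂ) * l₀ b.tgt * (((bgUnits F K U₀ b)⁻¹ : (Matrix (Fin 2) (Fin 2) ℂ)ˣ) : Matrix (Fin 2) (Fin 2) ℂ)) ∧
          ∀ y : Site (F.P K) (K - n), l₀ (embIter (K - n) y) = cf y)
    {a : ℝ} (ha : 0 ≤ a)
    {γ : ℝ} (hγ : 0 < γ) (hco : ∀ v : BondL2K ℂ 3 (periodsT3 F K) c₀ W₂, γ * ‖v‖ ^ 2 ≤ RCLike.re ⟪v, laplaceA F n K h c₀ cB a (DeltaEtaSlot F n K c₀) U₀ v⟫_ℂ)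
    {r μ' CkD : ℝ} (hr : 0 < r) (hrμ : r < μ') (hCkD : 0 ≤ CkD)
    (hkD : ∀ (b : PBond (F.P K) 0) (Z : Matrix (Fin 2) (Fin 2) ℂ) (bd : PBond (F.P K) 0),
      ‖(toL2 F K c₀).symm (DL2 F n K c₀ U₀ (DstarL2 F n K c₀ U₀ (toL2 F K c₀ (Pi.single b Z))
          - RS F n K h c₀ cB U₀ (DstarL2 F n K c₀ U₀ (toL2 F K c₀ (Pi.single b Z))))) bd‖
        ≤ CkD * Real.exp (-(μ' * (Site.tdist (P := F.P K) (iterBlockOf (K - n) b.src) (iterBlockOf (K - n) bd.src) : ℝ))) * ‖Z‖)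
    {ε : ℝ} (hε : 0 < ε) (hε1 : ε ≤ 1)
    (hΘ : 0 < ((1 - ε) * γ - ε * ((32 * Real.sqrt 2 * ε₀ * (((F.P K).d : ℝ) * (2 * 3) ^ (F.P K).d)) + (33 / 8 : ℝ) ^ 2 * (600 * (27 / 4 : ℝ) ^ 6)) - 3 * (r ^ 2 * Real.exp (2 * r)) * (1 + 1 / ε)
            - (a * (2 * Real.sqrt (216 * (Real.exp (r * (((F.P K).d : ℝ) + 1)) - 1) ^ 2 * (cB / (c₀ * ((F.L : ℝ) ^ (K - n)) ^ 3))) * (6 * Real.sqrt (cB / c₀) * Real.sqrt (((F.L : ℝ) ^ (K - n))⁻¹ ^ 3))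
                  + 216 * (Real.exp (r * (((F.P K).d : ℝ) + 1)) - 1) ^ 2 * (cB / (c₀ * ((F.L : ℝ) ^ (K - n)) ^ 3)))
              + Real.sqrt 2 * CkD * (r * (F.P K).d * Real.exp (r * (F.P K).d) / min 1 ((μ' - r) / 2))
                  * (((F.P K).d : ℝ) * ((((F.P K).L : ℝ) ^ (F.P K).d) ^ (K - n)) * (2 * (1 + 1 / (μ' - (r + min 1 ((μ' - r) / 2))))) ^ 3)
              + 32 * Real.sqrt 2 * ε₀ * (((F.P K).d : ℝ) * (2 * 3) ^ (F.P K).d) * (1 + Real.exp (2 * r)))))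
    (hsmall : (32 * Real.sqrt 2 * ε₀ * Real.exp (5 * r)) * (8 * Real.exp (3 * r)) * 14 < 1) :
    ∀ (b : PBond (F.P K) 0) (Z : Matrix (Fin 2) (Fin 2) ℂ) (y : Site (F.P K) (K - n)),
      ∑ bd ∈ Finset.univ.filter (fun bd : PBond (F.P K) 0 => iterBlockOf (K - n) bd.src = y),
          ‖(toL2 F K c₀).symm (GT F n K h c₀ cB a (DeltaEtaSlot F n K c₀) U₀ (toL2 F K c₀ (Pi.single b Z))) bd‖
        ≤ 2 * (((Real.sqrt 2 + Real.sqrt 2 * (((2 * a * 5 ^ 2 * (cB / c₀) * ((F.L : ℝ) ^ (K - n))⁻¹ ^ 6 * Real.exp μ') + CkD) * Real.sqrt (((F.P K).d : ℝ) * ((((F.P K).L : ℝ) ^ (F.P K).d) ^ (K - n)) / c₀) * (Real.exp (6 * r) * Real.sqrt (2 * c₀ * (((F.P K).d : ℝ) * ((((F.P K).L : ℝ) ^ (F.P K).d) ^ (K - n)))) / ((1 - ε) * γ - ε * ((32 * Real.sqrt 2 * ε₀ * (((F.P K).d : ℝ) * (2 * 3) ^ (F.P K).d)) + (33 / 8 :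 ℝ) ^ 2 * (600 * (27 / 4 : ℝ) ^ 6)) - 3 * (r ^ 2 * Real.exp (2 * r)) * (1 + 1 / ε) - ((a * (2 * Real.sqrt (216 * (Real.exp (r * (((F.P K).d : ℝ) + 1)) - 1) ^ 2 * (cB / (c₀ * ((F.L : ℝ) ^ (K - n)) ^ 3))) * (6 * Real.sqrt (cB / c₀) * Real.sqrt (((F.L : ℝ) ^ (K - n))⁻¹ ^ 3))
                  + 216 * (Real.exp (r * (((F.P K).d : ℝ) + 1)) - 1) ^ 2 * (cB / (c₀ * ((F.L : ℝ) ^ (K - n)) ^ 3)))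
              + Real.sqrt 2 * CkD * (r * (F.P K).d * Real.exp (r * (F.P K).d) / min 1 ((μ' - r) / 2))
                  * (((F.P K).d : ℝ) * ((((F.P K).L : ℝ) ^ (F.P K).d) ^ (K - n)) * (2 * (1 + 1 / (μ' - (r + min 1 ((μ' - r) / 2))))) ^ 3)
              + 32 * Real.sqrt 2 * ε₀ * (((F.P K).d : ℝ) * (2 * 3) ^ (F.P K).d) * (1 + Real.exp (2 * r)))))) * (2 * (1 + 1 / (μ' - r))) ^ 3)) * (8 * Real.exp (3 * r)) * 14
              + Real.sqrt (3 ^ 3 * 8 / (c₀ * ((F.L : ℝ) ^ (K - n)) ^ 3)) * (Real.sqrt (8 * Real.exp (3 * r) * (2 * (1 + 1 / r)) ^ 3) * (Real.exp (6 * r) * Real.sqrt (2 * c₀ * (((F.P K).d : ℝ) * ((((F.P K).L : ℝ) ^ (F.P K).d) ^ (K - n)))) / ((1 - ε) * γ - ε * ((32 * Real.sqrt 2 * ε₀ * (((F.P K).d : ℝ) * (2 * 3) ^ (F.P K).d)) + (33 / 8 : ℝ) ^ 2 * (600 * (27 / 4 : ℝ) ^ 6)) - 3 * (r ^ 2 *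 Real.exp (2 * r)) * (1 + 1 / ε) - ((a * (2 * Real.sqrt (216 * (Real.exp (r * (((F.P K).d : ℝ) + 1)) - 1) ^ 2 * (cB / (c₀ * ((F.L : ℝ) ^ (K - n)) ^ 3))) * (6 * Real.sqrt (cB / c₀) * Real.sqrt (((F.L : ℝ) ^ (K - n))⁻¹ ^ 3))
                  + 216 * (Real.exp (r * (((F.P K).d : ℝ) + 1)) - 1) ^ 2 * (cB / (c₀ * ((F.L : ℝ) ^ (K - n)) ^ 3)))
              + Real.sqrt 2 * CkD * (r * (F.P K).d * Real.exp (r * (F.P K).d) / min 1 ((μ' - r) / 2))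
                  * (((F.P K).d : ℝ) * ((((F.P K).L : ℝ) ^ (F.P K).d) ^ (K - n)) * (2 * (1 + 1 / (μ' - (r + min 1 ((μ' - r) / 2))))) ^ 3)
              + 32 * Real.sqrt 2 * ε₀ * (((F.P K).d : ℝ) * (2 * 3) ^ (F.P K).d) * (1 + Real.exp (2 * r))))))))
            / (1 - (32 * Real.sqrt 2 * ε₀ * Real.exp (5 * r)) * (8 * Real.exp (3 * r)) * 14))
          * Real.exp (-((min r (1 / 4) / 2) * (Site.tdist (P := F.P K) y (iterBlockOf (K - n) b.src) : ℝ))) * ‖Z‖ := by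
  have hc₀ : 0 < c₀ := Fact.out
  have hcB : 0 < cB := Fact.out
  have hp : PosOnto F n K h c₀ cB a (DeltaEtaSlot F n K c₀) U₀ :=
    ⟨fun x hx => lt_of_lt_of_le (mul_pos hγ (pow_pos (norm_pos_iff.mpr hx) 2)) (hco x), surjective_Qk_of_regPr F h hnK c₀ cB hreg hwin⟩
  have hQ : ∀ v : BondL2K ℂ 3 (periodsT3 F K) c₀ W₂, ‖Qk F n K h c₀ cB U₀ v‖ ≤ (6 * Real.sqrt (cB / c₀) * Real.sqrt (((F.L : ℝ) ^ (K - n))⁻¹ ^ 3)) * ‖v‖ :=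
    fun v => norm_Qk_le_of_regPr F h c₀ cB hε₀ hε10 hWε U₀ hreg v
  have hVconj := hVconj_phaseClass_of_letters F h c₀ cB (a := a) hε₀ hε10 hWε U₀ hreg ha hr.le hrμ hCkD hkD hQ
  have hVlow := hVlow_abs_of_lift F h c₀ cB (a := a) hnK hε₀ hWε U₀ hreg ha hlift
  have hkQ := hkQ_of_regPr F h c₀ cB hε₀ hε10 hWε U₀ hreg ha (le_of_lt (hr.trans hrμ))
  exact blockColumn_GT_DeltaEtaSlot_of_letters (h := h) (cB := cB) (a := a) hnK.le hε₀.le U₀ hreg hp hr hε hε1 hco hVlow hVconj hΘ hCkD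
    (by positivity) hrμ hkD hkQ hsmall

end Summit.QuantumFields.YangMills.Theorems.Prop7OneFormGreenBlockColumnOfLiftAbs

end
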